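/-
Copyright (c) 2026 the pub-hodgecm-mathlib formalisation cell (harness21).  Prover seat hodgecm-mathlib-K2E4-p06 (g2), Track B ∕ K2-LIT (build stream 29),
h413 = `stmt-HodgeConjecture-24833`, line (ii′) (lead: this seat): the STABLE RIDER of the Euler–Poincaré witness — ‹(S′)› (K2E4-p21 (g2), ★ p855829) → ‹(S′♮)›.  2026-09-04.
-/
import Summits.HodgeConjecture.HodgeConjecture.Theorems.K2E3SingularTransferSignedOfLimitFormulas   -- ★ p855452 (this seat): the frame-light imports
import Summits.HodgeConjecture.HodgeConjecture.Theorems.F0P3cStCharTSEllMassHOrbEll                -- ★ `compactSpace_centralizer_fst_of_centralizerH`, `compactSpace_centralizerH_of_fst` (+ ★ `isGRegular_of_isStablyConjH`, `isRegularElt_fst_snd_of_isLocalGRegular`)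
import Literature.NumberTheory.Automorphic.UnitaryRankTwoRegularTorusTrichotomy                    -- ★ `exists_split_eigenframe_of_not_compactSpace_centralizer`, `not_compactSpace_centralizer_cmDatum_two_of_split_eigenframe`
import Literature.NumberTheory.Automorphic.LocalUnitaryGroupCongr                                  -- ★ `antidiagOne_isHermitian`, `isUnit_antidiagOne_det`
import HarnessLib

/-!
# h413 ∕ Track B «K2-LIT», line (ii′) — THE STABLE RIDER: ‹(S′) `sig_K2E3CentralGermEPWitness`› → ‹(S′♮) `sig_K2E3CentralGermEPWitnessStable`› (helper, `--supports`)

Cell `pub/hodgecm-mathlib`, crux H413 = `stmt-HodgeConjecture-24833`, route `HCCMUnconditional`; dealer-of-record K2E3-plan (g1); line (ii′) lead K2E4-p06 (g2).  THEOREMS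
ONLY (no `def`, no `instance`, no `notation`, no `sorry`, default heartbeats); count-neutral.  Hypothesis = K2E4-p21 (g2)'s cand (S′) `sig_K2E3CentralGermEPWitness`
(`K2/K2E4-p21/g2/sig_K2E3CentralGermEPWitness.cand.K2E4-p21-g2.lean` fe1cba6aeecc86e5, K2E3-r01 pre-hosting box PASS 23:49:43Z, PAID at every non-split `v` by ★ p855829
`K2E3CentralGermEPWitness.centralGermEPWitness`) VERBATIM; conclusion = this seat's cand (S′♮) `sig_K2E3CentralGermEPWitnessStable` (`K2/K2E4-p06/g2/…`, c833013bb4323af6)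
VERBATIM = (S′)'s conjuncts + the STABLE RIDER `Φ^st(γ, f₀) = κ·nst(γ)` (`nst(γ) = ({c : ConjClasses H_v | γ ∼_st out c}).ncard`) at every elliptic `G`-regular `γ`, which
is the (S′♮) hypothesis of ★ p855822 `K2E3CentralGermExpansionHOfEPWitness.centralGermExpansionH_of_EPWitness` (the core (ii♭′)).

THE MATHEMATICS.  (S′) gives `Φ(⟦γ′⟧, f₀) = κ` for every `G`-regular `γ′ ∈ H_v` with compact centraliser.  Every class in the stable class of an elliptic `G`-regular
`γ` is again elliptic `G`-regular: `G`-regularity is a function of the characteristic polynomials (★ `isGRegular_of_isStablyConjH`), and at a non-split `v` a regular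
`γ₂ ∈ U(Φ₂)(L⁺_v)` has NON-compact centraliser iff it has a SPLIT EIGENFRAME `γ₂ P = P·diag(u)`, `σ(u₀)u₀ ≠ 1` (★ `not_compactSpace_centralizer_iff_exists_split_eigenframe`,
Rogawski §3.6) — a property transported along `GL₂(E_v)`-conjugacy (`P ↦ cP`), while `Z_H((γ₂, γ₁))` is compact iff `Z(γ₂)` is (★ `compactSpace_centralizer_fst_of_centralizerH`,
★ `compactSpace_centralizerH_of_fst`; `U(Φ₁)(L⁺_v)` is compact).  Hence `Φ^st(γ, f₀) = Σᶠ_{c ∈ st(γ)} Φ(c, f₀) = κ · #st(γ)` (a `finsum` of the constant `κ`; if the index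
set were infinite both sides vanish by the `finsum`∕`ncard` conventions).
* §1 `finsum_mem_eq_mul_ncard_of_forall_eq` — `Σᶠ_{i ∈ s} g i = κ · s.ncard` when `g = κ` on `s`.
* §2 `compactSpace_centralizer_of_isLocalStablyConjH` — stable conjugacy preserves ellipticity of `G`-regular elements of `H_v` (non-split `v`).
* §3 `centralGermEPWitnessStable_of_EPWitness : ‹(S′)› → ‹(S′♮)›`.
[Rogawski1990 §3.5 Prop. 3.5.2 p. 25, §3.6 Lemma 3.6.1 p. 28; §4.1 (4.1.1) p. 39; §4.3 p. 42; §12.6 p. 174; Kottwitz1988 §2 Thm. 2.]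
HONEST LABEL: HC_CM is proved only modulo the 7 printed citations (2 remaining named inputs: hLiu418 = stmt-HodgeConjecture-24832, h413 = stmt-HodgeConjecture-24833) until rung 0 closes; implication only — (S′) is ★ (p855829), so (S′♮) is ★ the moment the dealer ties it.

## References
* [Rogawski1990] J. D. Rogawski, *Automorphic Representations of Unitary Groups in Three Variables*, Ann. of Math. Stud. 123 (1990): §3.5–§3.6 pp. 25–29; §4.1 p. 39;
  §4.3 p. 42; §12.6 p. 174.
* [Kottwitz1988] R. E. Kottwitz, *Tamagawa numbers*, Ann. of Math. 127 (1988), §2 Theorem 2.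
* [PlatonovRapinchuk1994] V. Platonov, A. Rapinchuk, *Algebraic Groups and Number Theory* (1994), §3.3 (anisotropic tori over local fields are compact).
-/

set_option autoImplicit false
set_option linter.dupNamespace false

noncomputable section

open Filter Topology
open MeasureTheory Measure NumberField IsDedekindDomain
open Literature.MeasureTheory.Group Literature.MeasureTheory.RestrictedProduct
open Literature.Topology.RestrictedProduct Literature.Topology.Algebra.RestrictedProduct
open Literature.NumberTheory.Rogawski1990 Literature.NumberTheory.Automorphic
open Literature.AlgebraicGeometry.ShimuraVarieties (unitaryGroup hermForm)
open scoped Matrix MatrixGroups RestrictedProduct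

namespace Summit.HodgeConjecture.HodgeConjecture.Cruxes.H413.K2E3CentralGermEPWitnessStableOfEPWitness

/-! ## §0–§2 Generic lemmas -/

/-- At a non-split `v` (one place `w ∣ v`) every place over `v` is fixed by complex conjugation. [cite: Rogawski1990, §3.6 p. 28] -/
private theorem smul_eq_of_subsingleton_placesOver₁₅ (L : Type) [Field L] [NumberField L] [IsCMField L] {v : HeightOneSpectrum (𝓞 ↥(maximalRealSubfield L))}
    (hv : Subsingleton (UnitaryGroup.PlacesOver L v)) (w : UnitaryGroup.PlacesOver L v) : IsCMField.complexConj L • w.1 = w.1 := by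
  have hmem : (IsCMField.complexConj L • w.1).under (𝓞 ↥(maximalRealSubfield L)) = v := by
    rw [HeightOneSpectrum.under_algEquiv_smul]; exact w.2
  exact congrArg Subtype.val (Subsingleton.elim (⟨IsCMField.complexConj L • w.1, hmem⟩ : UnitaryGroup.PlacesOver L v) w)

/-- §1 **A `finsum` of a constant**: if `g = κ` on `s` then `Σᶠ_{i ∈ s} g i = κ · s.ncard` (both sides vanish when `s` is infinite). [folklore] -/
theorem finsum_mem_eq_mul_ncard_of_forall_eq {ι : Type*} (s : Set ι) (g : ι → ℂ) (κ : ℂ) (h : ∀ i ∈ s, g i = κ) :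
    ∑ᶠ i ∈ s, g i = κ * (s.ncard : ℂ) := by
  by_cases hs : s.Finite
  · rw [finsum_mem_eq_finite_toFinset_sum g hs, Set.ncard_eq_toFinset_card s hs,
      Finset.sum_congr rfl (fun i hi => h i (hs.mem_toFinset.1 hi)), Finset.sum_const, nsmul_eq_mul, mul_comm]
  · rw [Set.Infinite.ncard hs, Nat.cast_zero, mul_zero]
    by_cases hκ : κ = 0
    · exact finsum_mem_of_eqOn_zero (fun i hi => (h i hi).trans hκ)
    · refine finsum_mem_eq_zero_of_infinite ?_
      have hsupp : s ∩ Function.support g = s :=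
        Set.inter_eq_left.2 (fun i hi => by rw [Function.mem_support, h i hi]; exact hκ)
      rw [hsupp]; exact hs

/-- §2 **STABLE CONJUGACY PRESERVES ELLIPTICITY OF `G`-REGULAR ELEMENTS OF `H_v = U(Φ₂)(L⁺_v) × U(Φ₁)(L⁺_v)`** (non-split `v`): if `γ` is `G`-regular with compact
centraliser and `γ ∼_st γ′`, then `Z_H(γ′)` is compact.  (`γ′` is `G`-regular ★; were `Z(γ′.1)` non-compact, `γ′.1` would have a split eigenframe `γ′.1 P = P·diag(u)`,
`σ(u₀)u₀ ≠ 1` ★, and conjugating by `c ∈ GL₂(E_v)` with `c γ′.1 c⁻¹ = γ.1` gives the split eigenframe `cP` of `γ.1`, so `Z(γ.1)` would be non-compact ★ — but it is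
compact since `Z_H(γ)` is ★; finally `Z_H(γ′)` is compact since `Z(γ′.1)` is ★.)
[cite: Rogawski1990, §3.6 Lemma 3.6.1 p. 28; §4.3 p. 42] [cite: PlatonovRapinchuk1994, §3.3] -/
theorem compactSpace_centralizer_of_isLocalStablyConjH (L : Type) [Field L] [NumberField L] [IsCMField L] (v : HeightOneSpectrum (𝓞 ↥(maximalRealSubfield L)))
    (hsub : Subsingleton (UnitaryGroup.PlacesOver L v))
    {γ γ' : (UnitaryGroup.cmDatum L 2 (Matrix.of fun i j : Fin 2 => if i.val + j.val + 1 = 2 then (1 : L) else 0)).Local v × (UnitaryGroup.cmDatum L 1 (Matrix.of fun i j : Fin 1 => if i.val + j.val + 1 = 1 then (1 : L) else 0)).Local v}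
    (hreg : IsLocalGRegular L v γ) (hc : CompactSpace (Subgroup.centralizer ({γ} : Set ((UnitaryGroup.cmDatum L 2 (Matrix.of fun i j : Fin 2 => if i.val + j.val + 1 = 2 then (1 : L) else 0)).Local v × (UnitaryGroup.cmDatum L 1 (Matrix.of fun i j : Fin 1 => if i.val + j.val + 1 = 1 then (1 : L) else 0)).Local v))))
    (hst : IsLocalStablyConjH L v γ γ') :
    CompactSpace (Subgroup.centralizer ({γ'} : Set ((UnitaryGroup.cmDatum L 2 (Matrix.of fun i j : Fin 2 => if i.val + j.val + 1 = 2 then (1 : L) else 0)).Local v × (UnitaryGroup.cmDatum L 1 (Matrix.of fun i j : Fin 1 => if i.val + j.val + 1 = 1 then (1 : L) else 0)).Local v))) := by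
  obtain ⟨w⟩ : Nonempty (UnitaryGroup.PlacesOver L v) := inferInstance
  have hw : IsCMField.complexConj L • w.1 = w.1 := smul_eq_of_subsingleton_placesOver₁₅ L hsub w
  have hns : ∀ w' : UnitaryGroup.PlacesOver L v, IsCMField.complexConj L • w'.1 = w'.1 := fun w' => smul_eq_of_subsingleton_placesOver₁₅ L hsub w'
  have hreg' : IsLocalGRegular L v γ' := isGRegular_of_isStablyConjH _ _ _ _ hst hreg
  have hr' : IsRegularElt (γ'.1.val : GL (Fin 2) (UnitaryGroup.LocalRing L v)) := (isRegularElt_fst_snd_of_isLocalGRegular L v γ' hreg').1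
  haveI := hc
  have hc1 : CompactSpace (Subgroup.centralizer ({γ.1} : Set ((UnitaryGroup.cmDatum L 2 (Matrix.of fun i j : Fin 2 => if i.val + j.val + 1 = 2 then (1 : L) else 0)).Local v))) :=
    F0P3cStCharTSEllMassHOrbEll.compactSpace_centralizer_fst_of_centralizerH L v γ
  haveI : CompactSpace (Subgroup.centralizer ({γ'.1} : Set ((UnitaryGroup.cmDatum L 2 (Matrix.of fun i j : Fin 2 => if i.val + j.val + 1 = 2 then (1 : L) else 0)).Local v))) := by
    by_contra hnc
    obtain ⟨P, u, hP, -, h0⟩ := UnitaryGroup.exists_split_eigenframe_of_not_compactSpace_centralizer L v w hw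
      (UnitaryGroup.antidiagOne_isHermitian L 2) (UnitaryGroup.isUnit_antidiagOne_det L 2).ne_zero γ'.1 hr' hnc
    obtain ⟨c, hcγ⟩ := isConj_iff.1 hst.1.symm
    have hP' : γ.1.val.val * (c * P).val = (c * P).val * Matrix.diagonal u := by
      calc γ.1.val.val * (c * P).val = (c * γ'.1.val * c⁻¹).val * (c.val * P.val) := by rw [hcγ, Units.val_mul]
        _ = c.val * (γ'.1.val.val * P.val) := by simp only [Units.val_mul, Matrix.mul_assoc, Units.inv_mul_cancel_left]
        _ = (c * P).val * Matrix.diagonal u := by rw [hP, Units.val_mul, Matrix.mul_assoc]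
    exact UnitaryGroup.not_compactSpace_centralizer_cmDatum_two_of_split_eigenframe L v w hw
      (UnitaryGroup.antidiagOne_isHermitian L 2) (UnitaryGroup.isUnit_antidiagOne_det L 2).ne_zero γ.1 hP' h0 hc1
  exact F0P3cStCharTSEllMassHOrbEll.compactSpace_centralizerH_of_fst L v hns γ'

/-! ## §3 The stable rider -/

/-- §3 **‹(S′)› → ‹(S′♮)›: THE EULER–POINCARÉ WITNESS WITH ITS STABLE RIDER** (hypothesis = K2E4-p21's (S′) cand bytes fe1cba6a VERBATIM, ★ p855829; conclusion = the (S′♮)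
cand bytes c833013b VERBATIM).  The extra conjunct: `Φ^st(γ, f₀) = Σᶠ_{c ∈ st(γ)} Φ(c, f₀)` (★ `stableOrbitalIntegralRel_def`) and every `c` there is the class of an
elliptic `G`-regular element (§2 + ★ `isGRegular_of_isStablyConjH`), where `Φ(c, f₀) = κ` by (S′); §1 sums the constant.
[cite: Rogawski1990, §4.1 (4.1.1) p. 39; §3.6 p. 28; §12.6 p. 174] [cite: Kottwitz1988, §2 Thm. 2] -/
theorem centralGermEPWitnessStable_of_EPWitness
    (hW :
    ∀ (L : Type) [Field L] [NumberField L] [IsCMField L] (H' : Matrix (Fin 3) (Fin 3) L),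
      (H'.map (cmConjRingHom L)).transpose = H' →
      (∀ x : Fin 3 → L, hermForm (cmConjRingHom L) H' x x = 0 → x = 0) →
    ∀ (v : HeightOneSpectrum (𝓞 ↥(maximalRealSubfield L)))
      [MeasurableSpace ((UnitaryGroup.cmDatum L 2 (Matrix.of fun i j : Fin 2 => if i.val + j.val + 1 = 2 then (1 : L) else 0)).Local v × (UnitaryGroup.cmDatum L 1 (Matrix.of fun i j : Fin 1 => if i.val + j.val + 1 = 1 then (1 : L) else 0)).Local v)] [BorelSpace ((UnitaryGroup.cmDatum L 2 (Matrix.of fun i j : Fin 2 => if i.val + j.val + 1 = 2 then (1 : L) else 0)).Local v × (UnitaryGroup.cmDatum L 1 (Matrix.of fun i j : Fin 1 => if i.val + j.val + 1 = 1 then (1 : L) else 0)).Local v)]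
      [∀ a : (UnitaryGroup.cmDatum L 2 (Matrix.of fun i j : Fin 2 => if i.val + j.val + 1 = 2 then (1 : L) else 0)).Local v × (UnitaryGroup.cmDatum L 1 (Matrix.of fun i j : Fin 1 => if i.val + j.val + 1 = 1 then (1 : L) else 0)).Local v,
        MeasurableSpace (((UnitaryGroup.cmDatum L 2 (Matrix.of fun i j : Fin 2 => if i.val + j.val + 1 = 2 then (1 : L) else 0)).Local v × (UnitaryGroup.cmDatum L 1 (Matrix.of fun i j : Fin 1 => if i.val + j.val + 1 = 1 then (1 : L) else 0)).Local v) ⧸ Subgroup.centralizer ({a} : Set ((UnitaryGroup.cmDatum L 2 (Matrix.of fun i j : Fin 2 => if i.val + j.val + 1 = 2 then (1 : L) else 0)).Local v × (UnitaryGroup.cmDatum L 1 (Matrix.of fun i j : Fin 1 => if i.val + j.val + 1 = 1 then (1 : L) else 0)).Local v)))]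
      [∀ a : (UnitaryGroup.cmDatum L 2 (Matrix.of fun i j : Fin 2 => if i.val + j.val + 1 = 2 then (1 : L) else 0)).Local v × (UnitaryGroup.cmDatum L 1 (Matrix.of fun i j : Fin 1 => if i.val + j.val + 1 = 1 then (1 : L) else 0)).Local v,
        BorelSpace (((UnitaryGroup.cmDatum L 2 (Matrix.of fun i j : Fin 2 => if i.val + j.val + 1 = 2 then (1 : L) else 0)).Local v × (UnitaryGroup.cmDatum L 1 (Matrix.of fun i j : Fin 1 => if i.val + j.val + 1 = 1 then (1 : L) else 0)).Local v) ⧸ Subgroup.centralizer ({a} : Set ((UnitaryGroup.cmDatum L 2 (Matrix.of fun i j : Fin 2 => if i.val + j.val + 1 = 2 then (1 : L) else 0)).Local v × (UnitaryGroup.cmDatum L 1 (Matrix.of fun i j : Fin 1 => if i.val + j.val + 1 = 1 then (1 : L) else 0)).Local v)))]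
      [MeasurableSpace ((UnitaryGroup.cmDatum L 3 H').Local v)] [BorelSpace ((UnitaryGroup.cmDatum L 3 H').Local v)]
      [∀ γ : (UnitaryGroup.cmDatum L 3 H').Local v, MeasurableSpace ((UnitaryGroup.cmDatum L 3 H').Local v ⧸ Subgroup.centralizer ({γ} : Set ((UnitaryGroup.cmDatum L 3 H').Local v)))]
      [∀ γ : (UnitaryGroup.cmDatum L 3 H').Local v, BorelSpace ((UnitaryGroup.cmDatum L 3 H').Local v ⧸ Subgroup.centralizer ({γ} : Set ((UnitaryGroup.cmDatum L 3 H').Local v)))]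
      (νHv : Measure ((UnitaryGroup.cmDatum L 2 (Matrix.of fun i j : Fin 2 => if i.val + j.val + 1 = 2 then (1 : L) else 0)).Local v × (UnitaryGroup.cmDatum L 1 (Matrix.of fun i j : Fin 1 => if i.val + j.val + 1 = 1 then (1 : L) else 0)).Local v)) (νGv : Measure ((UnitaryGroup.cmDatum L 3 H').Local v))
      [IsFiniteMeasureOnCompacts νHv] [νHv.IsMulRightInvariant] [νGv.IsHaarMeasure] [νGv.IsMulRightInvariant]
      (Δv : LocalTransferFactor L H' v)
      (mHv : OrbitalMeasureFamily ((UnitaryGroup.cmDatum L 2 (Matrix.of fun i j : Fin 2 => if i.val + j.val + 1 = 2 then (1 : L) else 0)).Local v × (UnitaryGroup.cmDatum L 1 (Matrix.of fun i j : Fin 1 => if i.val + j.val + 1 = 1 then (1 : L) else 0)).Local v)) (mGv : OrbitalMeasureFamily ((UnitaryGroup.cmDatum L 3 H').Local v)),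
      IsLocalTransferDatum L H' v Δv mHv mGv →
      mHv.IsCanonical (IsLocalGRegular L v) νHv →
      mGv.IsCanonical (fun γ : (UnitaryGroup.cmDatum L 3 H').Local v => IsRegularElt (γ.val : GL (Fin 3) (UnitaryGroup.LocalRing L v))) νGv →
      Subsingleton (UnitaryGroup.PlacesOver L v) →
    ∀ z : (UnitaryGroup.cmDatum L 2 (Matrix.of fun i j : Fin 2 => if i.val + j.val + 1 = 2 then (1 : L) else 0)).Local v × (UnitaryGroup.cmDatum L 1 (Matrix.of fun i j : Fin 1 => if i.val + j.val + 1 = 1 then (1 : L) else 0)).Local v, z ∈ Subgroup.center ((UnitaryGroup.cmDatum L 2 (Matrix.of fun i j : Fin 2 => if i.val + j.val + 1 = 2 then (1 : L) else 0)).Local v × (UnitaryGroup.cmDatum L 1 (Matrix.of fun i j : Fin 1 => if i.val + j.val + 1 = 1 then (1 : L) else 0)).Local v) →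
    ∃ (f₀ : (UnitaryGroup.cmDatum L 2 (Matrix.of fun i j : Fin 2 => if i.val + j.val + 1 = 2 then (1 : L) else 0)).Local v × (UnitaryGroup.cmDatum L 1 (Matrix.of fun i j : Fin 1 => if i.val + j.val + 1 = 1 then (1 : L) else 0)).Local v → ℂ) (r κ : ℝ), IsLocSmooth f₀ ∧ 0 < r ∧ f₀ z = -(r : ℂ) ∧ 0 < κ ∧
      (∀ γ : (UnitaryGroup.cmDatum L 2 (Matrix.of fun i j : Fin 2 => if i.val + j.val + 1 = 2 then (1 : L) else 0)).Local v × (UnitaryGroup.cmDatum L 1 (Matrix.of fun i j : Fin 1 => if i.val + j.val + 1 = 1 then (1 : L) else 0)).Local v, IsLocalGRegular L v γ →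
        CompactSpace (Subgroup.centralizer ({γ} : Set ((UnitaryGroup.cmDatum L 2 (Matrix.of fun i j : Fin 2 => if i.val + j.val + 1 = 2 then (1 : L) else 0)).Local v × (UnitaryGroup.cmDatum L 1 (Matrix.of fun i j : Fin 1 => if i.val + j.val + 1 = 1 then (1 : L) else 0)).Local v))) →
        classOrbitalIntegral mHv f₀ (ConjClasses.mk γ) = (κ : ℂ)) ) :
    ∀ (L : Type) [Field L] [NumberField L] [IsCMField L] (H' : Matrix (Fin 3) (Fin 3) L),
      (H'.map (cmConjRingHom L)).transpose = H' →
      (∀ x : Fin 3 → L, hermForm (cmConjRingHom L) H' x x = 0 → x = 0) →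
    ∀ (v : HeightOneSpectrum (𝓞 ↥(maximalRealSubfield L)))
      [MeasurableSpace ((UnitaryGroup.cmDatum L 2 (Matrix.of fun i j : Fin 2 => if i.val + j.val + 1 = 2 then (1 : L) else 0)).Local v × (UnitaryGroup.cmDatum L 1 (Matrix.of fun i j : Fin 1 => if i.val + j.val + 1 = 1 then (1 : L) else 0)).Local v)] [BorelSpace ((UnitaryGroup.cmDatum L 2 (Matrix.of fun i j : Fin 2 => if i.val + j.val + 1 = 2 then (1 : L) else 0)).Local v × (UnitaryGroup.cmDatum L 1 (Matrix.of fun i j : Fin 1 => if i.val + j.val + 1 = 1 then (1 : L) else 0)).Local v)]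
      [∀ a : (UnitaryGroup.cmDatum L 2 (Matrix.of fun i j : Fin 2 => if i.val + j.val + 1 = 2 then (1 : L) else 0)).Local v × (UnitaryGroup.cmDatum L 1 (Matrix.of fun i j : Fin 1 => if i.val + j.val + 1 = 1 then (1 : L) else 0)).Local v,
        MeasurableSpace (((UnitaryGroup.cmDatum L 2 (Matrix.of fun i j : Fin 2 => if i.val + j.val + 1 = 2 then (1 : L) else 0)).Local v × (UnitaryGroup.cmDatum L 1 (Matrix.of fun i j : Fin 1 => if i.val + j.val + 1 = 1 then (1 : L) else 0)).Local v) ⧸ Subgroup.centralizer ({a} : Set ((UnitaryGroup.cmDatum L 2 (Matrix.of fun i j : Fin 2 => if i.val + j.val + 1 = 2 then (1 : L) else 0)).Local v × (UnitaryGroup.cmDatum L 1 (Matrix.of fun i j : Fin 1 => if i.val + j.val + 1 = 1 then (1 : L) else 0)).Local v)))]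
      [∀ a : (UnitaryGroup.cmDatum L 2 (Matrix.of fun i j : Fin 2 => if i.val + j.val + 1 = 2 then (1 : L) else 0)).Local v × (UnitaryGroup.cmDatum L 1 (Matrix.of fun i j : Fin 1 => if i.val + j.val + 1 = 1 then (1 : L) else 0)).Local v,
        BorelSpace (((UnitaryGroup.cmDatum L 2 (Matrix.of fun i j : Fin 2 => if i.val + j.val + 1 = 2 then (1 : L) else 0)).Local v × (UnitaryGroup.cmDatum L 1 (Matrix.of fun i j : Fin 1 => if i.val + j.val + 1 = 1 then (1 : L) else 0)).Local v) ⧸ Subgroup.centralizer ({a} : Set ((UnitaryGroup.cmDatum L 2 (Matrix.of fun i j : Fin 2 => if i.val + j.val + 1 = 2 then (1 : L) else 0)).Local v × (UnitaryGroup.cmDatum L 1 (Matrix.of fun i j : Fin 1 => if i.val + j.val + 1 = 1 then (1 : L) else 0)).Local v)))]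
      [MeasurableSpace ((UnitaryGroup.cmDatum L 3 H').Local v)] [BorelSpace ((UnitaryGroup.cmDatum L 3 H').Local v)]
      [∀ γ : (UnitaryGroup.cmDatum L 3 H').Local v, MeasurableSpace ((UnitaryGroup.cmDatum L 3 H').Local v ⧸ Subgroup.centralizer ({γ} : Set ((UnitaryGroup.cmDatum L 3 H').Local v)))]
      [∀ γ : (UnitaryGroup.cmDatum L 3 H').Local v, BorelSpace ((UnitaryGroup.cmDatum L 3 H').Local v ⧸ Subgroup.centralizer ({γ} : Set ((UnitaryGroup.cmDatum L 3 H').Local v)))]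
      (νHv : Measure ((UnitaryGroup.cmDatum L 2 (Matrix.of fun i j : Fin 2 => if i.val + j.val + 1 = 2 then (1 : L) else 0)).Local v × (UnitaryGroup.cmDatum L 1 (Matrix.of fun i j : Fin 1 => if i.val + j.val + 1 = 1 then (1 : L) else 0)).Local v)) (νGv : Measure ((UnitaryGroup.cmDatum L 3 H').Local v))
      [IsFiniteMeasureOnCompacts νHv] [νHv.IsMulRightInvariant] [νGv.IsHaarMeasure] [νGv.IsMulRightInvariant]
      (Δv : LocalTransferFactor L H' v)
      (mHv : OrbitalMeasureFamily ((UnitaryGroup.cmDatum L 2 (Matrix.of fun i j : Fin 2 => if i.val + j.val + 1 = 2 then (1 : L) else 0)).Local v × (UnitaryGroup.cmDatum L 1 (Matrix.of fun i j : Fin 1 => if i.val + j.val + 1 = 1 then (1 : L) else 0)).Local v)) (mGv : OrbitalMeasureFamily ((UnitaryGroup.cmDatum L 3 H').Local v)),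
      IsLocalTransferDatum L H' v Δv mHv mGv →
      mHv.IsCanonical (IsLocalGRegular L v) νHv →
      mGv.IsCanonical (fun γ : (UnitaryGroup.cmDatum L 3 H').Local v => IsRegularElt (γ.val : GL (Fin 3) (UnitaryGroup.LocalRing L v))) νGv →
      Subsingleton (UnitaryGroup.PlacesOver L v) →
    ∀ z : (UnitaryGroup.cmDatum L 2 (Matrix.of fun i j : Fin 2 => if i.val + j.val + 1 = 2 then (1 : L) else 0)).Local v × (UnitaryGroup.cmDatum L 1 (Matrix.of fun i j : Fin 1 => if i.val + j.val + 1 = 1 then (1 : L) else 0)).Local v, z ∈ Subgroup.center ((UnitaryGroup.cmDatum L 2 (Matrix.of fun i j : Fin 2 => if i.val + j.val + 1 = 2 then (1 : L) else 0)).Local v × (UnitaryGroup.cmDatum L 1 (Matrix.of fun i j : Fin 1 => if i.val + j.val + 1 = 1 then (1 : L) else 0)).Local v) →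
    ∃ (f₀ : (UnitaryGroup.cmDatum L 2 (Matrix.of fun i j : Fin 2 => if i.val + j.val + 1 = 2 then (1 : L) else 0)).Local v × (UnitaryGroup.cmDatum L 1 (Matrix.of fun i j : Fin 1 => if i.val + j.val + 1 = 1 then (1 : L) else 0)).Local v → ℂ) (r κ : ℝ), IsLocSmooth f₀ ∧ 0 < r ∧ f₀ z = -(r : ℂ) ∧ 0 < κ ∧
      (∀ γ : (UnitaryGroup.cmDatum L 2 (Matrix.of fun i j : Fin 2 => if i.val + j.val + 1 = 2 then (1 : L) else 0)).Local v × (UnitaryGroup.cmDatum L 1 (Matrix.of fun i j : Fin 1 => if i.val + j.val + 1 = 1 then (1 : L) else 0)).Local v, IsLocalGRegular L v γ → CompactSpace (Subgroup.centralizer ({γ} : Set ((UnitaryGroup.cmDatum L 2 (Matrix.of fun i j : Fin 2 => if i.val + j.val + 1 = 2 then (1 : L) else 0)).Local v × (UnitaryGroup.cmDatum L 1 (Matrix.of fun i j : Fin 1 => if i.val + j.val + 1 = 1 then (1 : L) else 0)).Local v))) →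
        classOrbitalIntegral mHv f₀ (ConjClasses.mk γ) = (κ : ℂ)) ∧
      (∀ γ : (UnitaryGroup.cmDatum L 2 (Matrix.of fun i j : Fin 2 => if i.val + j.val + 1 = 2 then (1 : L) else 0)).Local v × (UnitaryGroup.cmDatum L 1 (Matrix.of fun i j : Fin 1 => if i.val + j.val + 1 = 1 then (1 : L) else 0)).Local v, IsLocalGRegular L v γ → CompactSpace (Subgroup.centralizer ({γ} : Set ((UnitaryGroup.cmDatum L 2 (Matrix.of fun i j : Fin 2 => if i.val + j.val + 1 = 2 then (1 : L) else 0)).Local v × (UnitaryGroup.cmDatum L 1 (Matrix.of fun i j : Fin 1 => if i.val + j.val + 1 = 1 then (1 : L) else 0)).Local v))) →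
        stableOrbitalIntegralRel (IsLocalStablyConjH L v) mHv f₀ γ = (κ : ℂ) * (({c : ConjClasses ((UnitaryGroup.cmDatum L 2 (Matrix.of fun i j : Fin 2 => if i.val + j.val + 1 = 2 then (1 : L) else 0)).Local v × (UnitaryGroup.cmDatum L 1 (Matrix.of fun i j : Fin 1 => if i.val + j.val + 1 = 1 then (1 : L) else 0)).Local v) | IsLocalStablyConjH L v γ (Quotient.out c)} : Set (ConjClasses ((UnitaryGroup.cmDatum L 2 (Matrix.of fun i j : Fin 2 => if i.val + j.val + 1 = 2 then (1 : L) else 0)).Local v × (UnitaryGroup.cmDatum L 1 (Matrix.of fun i j : Fin 1 => if i.val + j.val + 1 = 1 then (1 : L) else 0)).Local v))).ncard : ℂ)) := by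
  intro L _ _ _ H' hherm hanis v _ _ _ _ _ _ _ _ νHv νGv _ _ _ _ Δv mHv mGv hdat hcanH hcanG hns z hz
  obtain ⟨f₀, r, κ, hf₀, hr, hz0, hκ, hcls⟩ := hW L H' hherm hanis v νHv νGv Δv mHv mGv hdat hcanH hcanG hns z hz
  refine ⟨f₀, r, κ, hf₀, hr, hz0, hκ, hcls, fun γ hγ hcγ => ?_⟩
  rw [stableOrbitalIntegralRel_def]
  refine finsum_mem_eq_mul_ncard_of_forall_eq _ _ _ (fun c hc => ?_)
  have hst : IsLocalStablyConjH L v γ (Quotient.out c) := hc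
  have hmk : ConjClasses.mk (Quotient.out c) = c := by
    rw [← ConjClasses.quotient_mk_eq_mk, Quotient.out_eq]
  rw [← hmk]
  exact hcls (Quotient.out c) (isGRegular_of_isStablyConjH _ _ _ _ hst hγ)
    (compactSpace_centralizer_of_isLocalStablyConjH L v hns hγ hcγ hst)

end Summit.HodgeConjecture.HodgeConjecture.Cruxes.H413.K2E3CentralGermEPWitnessStableOfEPWitness

end
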